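import Summits.ABC.ABC.Theorems.FeketeScalesScaleSubmultiplicativityNormalForms
import Summits.ABC.ABC.Theorems.FeketeScalesScaleSubmultiplicativitySharpExponent
import Summits.ABC.ABC.Theorems.FeketeScalesTargetEffective

/-!
# Crux `ScaleSubmultiplicativity` (stmt-ABC-2160): witness saturation — envelope witnesses are the sub-power slack

The crux of route `FeketeScales` (ABC/ABC) reads, G-free,
`∃ θ < 1, ∃ K > 0, ∃ R₀, ∀ R₁ R₂ ≥ R₀, ∀ abc triple T with rad T ≤ R₁R₂, ∃ abc triples T₁, T₂ with rad Tᵢ ≤ Rᵢ and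
c ≤ K · exp((log R₁R₂)^θ) · c₁ · c₂`.  A proof has to EXHIBIT the witnesses `T₁, T₂`.  Every witness family anybody can
certify — the dyadic triples `(1, 2ⁿ - 1, 2ⁿ)` (`cᵢ ≤ Rᵢ`), the Stewart–Tijdeman / van Frankenhuijsen / Bright
pigeonhole families (`cᵢ ≤ Rᵢ · e^{O(√log Rᵢ)}`), and, under Robert–Stewart–Tenenbaum's Conjecture A, every abc triple
whatsoever — is an ENVELOPE family: `cᵢ ≤ e^B · Rᵢ · exp((log Rᵢ)^θ)`.  This file puts the standing diagnosis of the
crux chain ("witness saturation", `Cruxes/ScaleSubmultiplicativity/STRATEGY-CENSUS.md` §1 (i) of seat p1 and S12 of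
seat s1) into the kernel:

* `ScaleSubmultiplicativity.subpowerSlack_of_envelopeWitnesses_at` / `…_of_envelopeWitnesses` — the crux proved with
  envelope witnesses of exponent `θ ∈ [0,1]` IS the pointwise sub-power slack `c < rad · exp(A (log rad)^θ)` for ALL
  abc triples (the hypothesis of the support item `SubmultOfRST`, stmt-ABC-10340), with the SAME exponent: shadow the
  triple `T` at the lopsided split `(S, S · rad T)`, `S = max R₀ 2`;
* `ScaleSubmultiplicativity.envelopeWitnesses_of_subpowerSlack` — conversely the sub-power slack with exponent `τ`
  gives the crux with envelope witnesses at `θ = (1 + τ⁺)/2` (every triple is then an envelope triple, and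
  `ScaleSubmultiplicativity.at_exponent_of_subpowerSlack` supplies the shadows);
* `ScaleSubmultiplicativity.envelopeWitnesses_iff_subpowerSlack` — hence EQUIVALENCE; and through the landed
  calibration `calib_subPowerSlack_iff_scaleSubmultiplicativity_and_effectiveGoodScales` of the sibling crux `Target`,
  `ScaleSubmultiplicativity.envelopeWitnesses_iff_scaleSubmultiplicativity_and_effectiveGoodScales`: a proof of the
  crux by envelope witnesses proves, on top of the crux, abc with an effective (quasi-polynomial) constant at all large
  scales;
* `ScaleSubmultiplicativity.subpowerSlack_of_linearWitnesses` — in particular witnesses of LINEAR height `cᵢ ≤ κ Rᵢ`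
  (the height-indexed dyadic family used by `submultOfRST_proof`, `SubmultOfRST.exists_triple_at_scale`) turn the crux
  into the sub-power slack verbatim;
* companion file `FeketeScalesScaleSubmultiplicativityEnvelopeWitnessesFloor.lean`: below `θ = 1/2` the
  envelope-witness form is FALSE outright, by Stewart–Tijdeman (`Literature.Barriers.ABC.EpsilonCannotBeDropped_holds`).

So on `[1/2, 1)` a proof of stmt-ABC-2160 by certified witnesses is a proof of Robert–Stewart–Tenenbaum-upper-lite
(summit-plus: `Target.abc_of_subPowerSlack`), and on `[0, 1/2)` there is none.  What is NOT claimed: that the crux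
itself implies the sub-power slack (open; the crux gives only polynomial abc, stmt-ABC-2163) — a proof may use witnesses
above every envelope, i.e. bursts, which nobody can construct (BarrierNotes-r2-k6 D0).  Kernel facts attached to the
crux (`--supports stmt-ABC-2160`); no bearing on its truth.  Pattern: folklore manipulations of sub-additive
inequalities.
Sources: [RobertStewartTenenbaum2014, Conjecture A (1.5), §1]; route file docstrings of stmt-ABC-2160 / stmt-ABC-10340.
-/

-- `Summit.<Summit>.<Problem>` is the mandated summit-side namespace (CONVENTIONS §2); for the
-- single-conjunct summit `ABC` the two coincide, so the duplicate `ABC.ABC` is deliberate.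
set_option linter.dupNamespace false

namespace Summit.ABC.ABC.Theorems

open Literature.NumberTheory.DiophantineGeometry
open Summit.ABC.ABC.Theses.FeketeScales

namespace ScaleSubmultiplicativity.EnvelopeWitnesses

/-! ### Scalar helpers -/

/-- For `r ≥ 2` and `0 ≤ θ ≤ 1` the slack exponent `(log r)^θ` is at least `1/2` (indeed `≥ log 2`): if `log r ≥ 1`
then `(log r)^θ ≥ 1`, else `(log r)^θ ≥ (log r)^1 ≥ log 2`. [folklore] -/
theorem half_le_log_rpow {r θ : ℝ} (hr : 2 ≤ r) (hθ0 : 0 ≤ θ) (hθ1 : θ ≤ 1) :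
    1 / 2 ≤ Real.log r ^ θ := by
  have hlog2 : Real.log 2 ≤ Real.log r := Real.log_le_log two_pos hr
  have h2 : (1 : ℝ) / 2 ≤ Real.log 2 := by
    have := Real.log_two_gt_d9
    linarith
  have hlog0 : 0 < Real.log r := lt_of_lt_of_le (by linarith) hlog2
  rcases le_or_gt 1 (Real.log r) with h1 | h1
  · exact le_trans (by norm_num) (Real.one_le_rpow h1 hθ0)
  · calc (1 : ℝ) / 2 ≤ Real.log r := h2.trans hlog2
      _ = Real.log r ^ (1 : ℝ) := (Real.rpow_one _).symm
      _ ≤ Real.log r ^ θ := Real.rpow_le_rpow_of_exponent_ge hlog0 h1.le hθ1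

/-- Absorbing a constant and a doubled slack into one sub-power slack with the SAME exponent: for `C > 0` and
`0 ≤ θ ≤ 1` there is `A` with `C · r · exp(2 (log r)^θ) < r · exp(A (log r)^θ)` for every real `r ≥ 2`
(take `A = 2 + 2(|log C| + 1)` and use `(log r)^θ ≥ 1/2`). [folklore] -/
theorem absorb_constant {C θ : ℝ} (hC : 0 < C) (hθ0 : 0 ≤ θ) (hθ1 : θ ≤ 1) :
    ∃ A : ℝ, ∀ r : ℝ, 2 ≤ r → C * r * Real.exp (2 * Real.log r ^ θ) < r * Real.exp (A * Real.log r ^ θ) := by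
  refine ⟨2 + 2 * (|Real.log C| + 1), fun r hr => ?_⟩
  have hm := half_le_log_rpow hr hθ0 hθ1
  set m : ℝ := Real.log r ^ θ with hm_def
  have hr0 : 0 < r := by linarith
  have hkey : Real.log C + 2 * m < (2 + 2 * (|Real.log C| + 1)) * m := by
    have habs : Real.log C ≤ |Real.log C| := le_abs_self _
    have h0 : 0 ≤ |Real.log C| := abs_nonneg _
    nlinarith
  have hexp : C * Real.exp (2 * m) < Real.exp ((2 + 2 * (|Real.log C| + 1)) * m) := by
    calc C * Real.exp (2 * m) = Real.exp (Real.log C + 2 * m) := by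
          rw [Real.exp_add, Real.exp_log hC]
      _ < Real.exp ((2 + 2 * (|Real.log C| + 1)) * m) := Real.exp_lt_exp.mpr hkey
  calc C * r * Real.exp (2 * m) = r * (C * Real.exp (2 * m)) := by ring
    _ < r * Real.exp ((2 + 2 * (|Real.log C| + 1)) * m) := mul_lt_mul_of_pos_left hexp hr0

end ScaleSubmultiplicativity.EnvelopeWitnesses

open ScaleSubmultiplicativity.EnvelopeWitnesses ScaleSubmultiplicativity.NormalForms

/-! ### Envelope witnesses force the pointwise sub-power slack, with the same exponent -/

/-- **Witness saturation, sharp form.**  Fix `θ ∈ [0,1]`, `K > 0`, `B`, `R₀`.  Suppose every abc triple of radical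
`≤ R₁R₂` (`R₁, R₂ ≥ R₀`) is shadowed, `c ≤ K e^{(log R₁R₂)^θ} c₁ c₂`, by abc triples of radical `≤ Rᵢ` that are
ENVELOPE triples, `cᵢ ≤ e^B · Rᵢ · exp((log Rᵢ)^θ)`.  Then EVERY abc triple satisfies the pointwise sub-power slack
`c < rad · exp(A (log rad)^θ)` for one real `A` — the hypothesis of `SubmultOfRST` with `τ = θ`.  Proof: shadow `T`
at the split `(S, S · rad T)`, `S = max R₀ 2`; sub-additivity `(log xy)^θ ≤ (log x)^θ + (log y)^θ` collects
`c ≤ (K e^{2B} S² e^{4(log S)^θ}) · rad T · exp(2 (log rad T)^θ)`, and `absorb_constant` renames the constant. [folklore] -/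
theorem ScaleSubmultiplicativity.subpowerSlack_of_envelopeWitnesses_at {θ K B : ℝ} {R₀ : ℕ}
    (hθ0 : 0 ≤ θ) (hθ1 : θ ≤ 1) (hK : 0 < K)
    (hS : ∀ R₁ R₂ : ℕ, R₀ ≤ R₁ → R₀ ≤ R₂ → ∀ a b c : ℕ, IsABCTriple a b c → rad a b c ≤ R₁ * R₂ →
      ∃ a₁ b₁ c₁ a₂ b₂ c₂ : ℕ, IsABCTriple a₁ b₁ c₁ ∧ rad a₁ b₁ c₁ ≤ R₁ ∧
        (c₁ : ℝ) ≤ Real.exp B * (R₁ : ℝ) * Real.exp (Real.log (R₁ : ℝ) ^ θ) ∧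
        IsABCTriple a₂ b₂ c₂ ∧ rad a₂ b₂ c₂ ≤ R₂ ∧
        (c₂ : ℝ) ≤ Real.exp B * (R₂ : ℝ) * Real.exp (Real.log (R₂ : ℝ) ^ θ) ∧
        (c : ℝ) ≤ K * Real.exp (Real.log ((R₁ : ℝ) * R₂) ^ θ) * c₁ * c₂) :
    ∃ A : ℝ, ∀ a b c : ℕ, IsABCTriple a b c →
      (c : ℝ) < ((rad a b c : ℕ) : ℝ) * Real.exp (A * Real.log ((rad a b c : ℕ) : ℝ) ^ θ) := by
  set S : ℕ := max R₀ 2 with hS_def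
  have hSR₀ : R₀ ≤ S := le_max_left _ _
  have hS2 : 2 ≤ S := le_max_right _ _
  have hS1r : (1 : ℝ) ≤ (S : ℝ) := by exact_mod_cast (show 1 ≤ S by omega)
  have hS0r : (0 : ℝ) < (S : ℝ) := by linarith
  -- the fixed factors at the small scale `S`
  set eS : ℝ := Real.exp (Real.log (S : ℝ) ^ θ) with heS_def
  have heS1 : 1 ≤ eS := Real.one_le_exp (Real.rpow_nonneg (Real.log_nonneg hS1r) θ)
  have heS0 : 0 < eS := by linarith
  set C : ℝ := K * Real.exp B ^ 2 * (S : ℝ) ^ 2 * eS ^ 4 with hC_def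
  have hC : 0 < C := by positivity
  obtain ⟨A, hA⟩ := absorb_constant hC hθ0 hθ1
  refine ⟨A, fun a b c habc => ?_⟩
  -- the triple and its radical
  set r : ℕ := rad a b c with hr_def
  have hr2 : 2 ≤ r := SubmultOfRST.two_le_rad habc
  have hr2r : (2 : ℝ) ≤ (r : ℝ) := by exact_mod_cast hr2
  have hr1r : (1 : ℝ) ≤ (r : ℝ) := by linarith
  have hr0r : (0 : ℝ) < (r : ℝ) := by linarith
  set eL : ℝ := Real.exp (Real.log (r : ℝ) ^ θ) with heL_def
  have heL0 : 0 < eL := Real.exp_pos _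
  -- shadow `T` at the split `(S, S * r)`
  have hR₂ : R₀ ≤ S * r := hSR₀.trans (Nat.le_mul_of_pos_right _ (by omega))
  have hrad : rad a b c ≤ S * (S * r) := by
    calc rad a b c = 1 * (1 * r) := by rw [hr_def]; ring
      _ ≤ S * (S * r) := Nat.mul_le_mul (by omega) (Nat.mul_le_mul (by omega) le_rfl)
  obtain ⟨a₁, b₁, c₁, a₂, b₂, c₂, _h₁, _hr₁, hc₁, _h₂, _hr₂, hc₂, hc⟩ := hS S (S * r) hSR₀ hR₂ a b c habc hrad
  have hcast : ((S * r : ℕ) : ℝ) = (S : ℝ) * (r : ℝ) := by push_cast; ring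
  rw [hcast] at hc₂ hc
  -- the three envelope / slack factors, bounded by products of `eS` and `eL`
  have hSr1 : (1 : ℝ) ≤ (S : ℝ) * r := one_le_mul_of_one_le_of_one_le hS1r hr1r
  have hE : Real.exp (Real.log ((S : ℝ) * ((S : ℝ) * r)) ^ θ) ≤ eS * (eS * eL) :=
    calc Real.exp (Real.log ((S : ℝ) * ((S : ℝ) * r)) ^ θ)
          ≤ Real.exp (Real.log (S : ℝ) ^ θ) * Real.exp (Real.log ((S : ℝ) * r) ^ θ) :=
            exp_log_mul_rpow_le hS1r hSr1 hθ0 hθ1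
      _ ≤ Real.exp (Real.log (S : ℝ) ^ θ) * (Real.exp (Real.log (S : ℝ) ^ θ) * Real.exp (Real.log (r : ℝ) ^ θ)) :=
            mul_le_mul_of_nonneg_left (exp_log_mul_rpow_le hS1r hr1r hθ0 hθ1) (Real.exp_pos _).le
      _ = eS * (eS * eL) := rfl
  have hc₁' : (c₁ : ℝ) ≤ Real.exp B * (S : ℝ) * eS := hc₁
  have hc₂' : (c₂ : ℝ) ≤ Real.exp B * ((S : ℝ) * r) * (eS * eL) :=
    calc (c₂ : ℝ) ≤ Real.exp B * ((S : ℝ) * r) * Real.exp (Real.log ((S : ℝ) * r) ^ θ) := hc₂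
      _ ≤ Real.exp B * ((S : ℝ) * r) * (eS * eL) :=
          mul_le_mul_of_nonneg_left (exp_log_mul_rpow_le hS1r hr1r hθ0 hθ1) (by positivity)
  -- collect: `c ≤ C · r · eL²`
  have hc0 : (0 : ℝ) ≤ (c₁ : ℝ) := Nat.cast_nonneg _
  have hc0' : (0 : ℝ) ≤ (c₂ : ℝ) := Nat.cast_nonneg _
  have hprod : (c : ℝ) ≤ K * (eS * (eS * eL)) * (Real.exp B * (S : ℝ) * eS) *
      (Real.exp B * ((S : ℝ) * r) * (eS * eL)) :=
    calc (c : ℝ) ≤ K * Real.exp (Real.log ((S : ℝ) * ((S : ℝ) * r)) ^ θ) * c₁ * c₂ := hc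
      _ ≤ K * (eS * (eS * eL)) * c₁ * c₂ := by gcongr
      _ ≤ K * (eS * (eS * eL)) * (Real.exp B * (S : ℝ) * eS) * (Real.exp B * ((S : ℝ) * r) * (eS * eL)) := by
          gcongr
  have hCform : K * (eS * (eS * eL)) * (Real.exp B * (S : ℝ) * eS) * (Real.exp B * ((S : ℝ) * r) * (eS * eL))
      = C * r * Real.exp (2 * Real.log (r : ℝ) ^ θ) := by
    have h2 : Real.exp (2 * Real.log (r : ℝ) ^ θ) = eL ^ 2 := by
      rw [two_mul, Real.exp_add, sq]
    rw [h2, hC_def]; ring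
  calc (c : ℝ) ≤ C * r * Real.exp (2 * Real.log (r : ℝ) ^ θ) := hprod.trans_eq hCform
    _ < (r : ℝ) * Real.exp (A * Real.log (r : ℝ) ^ θ) := hA (r : ℝ) hr2r

/-- **Witness saturation (existential form).**  If the crux holds with ENVELOPE witnesses — some `θ ∈ [0,1)`,
`K > 0`, `B`, `R₀` such that every abc triple of radical `≤ R₁R₂` (`R₁, R₂ ≥ R₀`) is shadowed by abc triples of
radical `≤ Rᵢ` and height `cᵢ ≤ e^B Rᵢ exp((log Rᵢ)^θ)` — then the pointwise sub-power slack holds for ALL abc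
triples: `∃ τ < 1, ∃ A, c < rad · exp(A (log rad)^τ)` (the hypothesis of `SubmultOfRST`, stmt-ABC-10340; by
`Target.abc_of_subPowerSlack` it implies `ABC`, and it is implied by `RSTConjectureAUpper`). [folklore] -/
theorem ScaleSubmultiplicativity.subpowerSlack_of_envelopeWitnesses :
    (∃ θ : ℝ, 0 ≤ θ ∧ θ < 1 ∧ ∃ K : ℝ, 0 < K ∧ ∃ B : ℝ, ∃ R₀ : ℕ, ∀ R₁ R₂ : ℕ, R₀ ≤ R₁ → R₀ ≤ R₂ →
      ∀ a b c : ℕ, IsABCTriple a b c → rad a b c ≤ R₁ * R₂ →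
      ∃ a₁ b₁ c₁ a₂ b₂ c₂ : ℕ, IsABCTriple a₁ b₁ c₁ ∧ rad a₁ b₁ c₁ ≤ R₁ ∧
        (c₁ : ℝ) ≤ Real.exp B * (R₁ : ℝ) * Real.exp (Real.log (R₁ : ℝ) ^ θ) ∧
        IsABCTriple a₂ b₂ c₂ ∧ rad a₂ b₂ c₂ ≤ R₂ ∧
        (c₂ : ℝ) ≤ Real.exp B * (R₂ : ℝ) * Real.exp (Real.log (R₂ : ℝ) ^ θ) ∧
        (c : ℝ) ≤ K * Real.exp (Real.log ((R₁ : ℝ) * R₂) ^ θ) * c₁ * c₂) →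
    ∃ τ : ℝ, τ < 1 ∧ ∃ A : ℝ, ∀ a b c : ℕ, IsABCTriple a b c →
      (c : ℝ) < ((rad a b c : ℕ) : ℝ) * Real.exp (A * Real.log ((rad a b c : ℕ) : ℝ) ^ τ) := by
  rintro ⟨θ, hθ0, hθ1, K, hK, B, R₀, hS⟩
  exact ⟨θ, hθ1, ScaleSubmultiplicativity.subpowerSlack_of_envelopeWitnesses_at hθ0 hθ1.le hK hS⟩

/-- **Linear-height witnesses.**  In particular, if the crux holds with witnesses of LINEAR height `cᵢ ≤ κ · Rᵢ`
(e.g. the height-indexed dyadic triples `(1, 2ⁿ-1, 2ⁿ)`, `2^{n+1} ≤ Rᵢ`, of `SubmultOfRST.exists_triple_at_scale`),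
then the pointwise sub-power slack holds for all abc triples: a linear witness is an envelope witness with `B = log κ`
since `exp((log Rᵢ)^θ) ≥ 1`. [folklore] -/
theorem ScaleSubmultiplicativity.subpowerSlack_of_linearWitnesses :
    (∃ θ : ℝ, 0 ≤ θ ∧ θ < 1 ∧ ∃ K : ℝ, 0 < K ∧ ∃ κ : ℝ, 0 < κ ∧ ∃ R₀ : ℕ, ∀ R₁ R₂ : ℕ, R₀ ≤ R₁ → R₀ ≤ R₂ →
      ∀ a b c : ℕ, IsABCTriple a b c → rad a b c ≤ R₁ * R₂ →
      ∃ a₁ b₁ c₁ a₂ b₂ c₂ : ℕ, IsABCTriple a₁ b₁ c₁ ∧ rad a₁ b₁ c₁ ≤ R₁ ∧ (c₁ : ℝ) ≤ κ * R₁ ∧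
        IsABCTriple a₂ b₂ c₂ ∧ rad a₂ b₂ c₂ ≤ R₂ ∧ (c₂ : ℝ) ≤ κ * R₂ ∧
        (c : ℝ) ≤ K * Real.exp (Real.log ((R₁ : ℝ) * R₂) ^ θ) * c₁ * c₂) →
    ∃ τ : ℝ, τ < 1 ∧ ∃ A : ℝ, ∀ a b c : ℕ, IsABCTriple a b c →
      (c : ℝ) < ((rad a b c : ℕ) : ℝ) * Real.exp (A * Real.log ((rad a b c : ℕ) : ℝ) ^ τ) := by
  rintro ⟨θ, hθ0, hθ1, K, hK, κ, hκ, R₀, hS⟩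
  refine ScaleSubmultiplicativity.subpowerSlack_of_envelopeWitnesses ⟨θ, hθ0, hθ1, K, hK, Real.log κ, R₀, ?_⟩
  intro R₁ R₂ hR₁ hR₂ a b c habc hrad
  obtain ⟨a₁, b₁, c₁, a₂, b₂, c₂, h₁, hr₁, hc₁, h₂, hr₂, hc₂, hc⟩ := hS R₁ R₂ hR₁ hR₂ a b c habc hrad
  have hlin : ∀ (R cᵢ : ℕ), (cᵢ : ℝ) ≤ κ * R →
      (cᵢ : ℝ) ≤ Real.exp (Real.log κ) * (R : ℝ) * Real.exp (Real.log (R : ℝ) ^ θ) := by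
    intro R cᵢ h
    rw [Real.exp_log hκ]
    have hR0 : (0 : ℝ) ≤ κ * R := by positivity
    have h1 : (1 : ℝ) ≤ Real.exp (Real.log (R : ℝ) ^ θ) :=
      Real.one_le_exp (Real.rpow_nonneg (Real.log_natCast_nonneg R) θ)
    calc (cᵢ : ℝ) ≤ κ * R := h
      _ = κ * R * 1 := (mul_one _).symm
      _ ≤ κ * R * Real.exp (Real.log (R : ℝ) ^ θ) := mul_le_mul_of_nonneg_left h1 hR0
  exact ⟨a₁, b₁, c₁, a₂, b₂, c₂, h₁, hr₁, hlin R₁ c₁ hc₁, h₂, hr₂, hlin R₂ c₂ hc₂, hc⟩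

/-! ### Conversely: under the sub-power slack every triple is an envelope triple -/

/-- **The sub-power slack gives the crux with envelope witnesses.**  If every abc triple has
`c < rad · exp(A (log rad)^τ)` (`τ < 1`), then with `θ := (1 + τ⁺)/2` (`τ⁺ = max τ 0`) the crux holds with envelope
witnesses of exponent `θ`: the shadows are supplied by `ScaleSubmultiplicativity.at_exponent_of_subpowerSlack`, and
EVERY abc triple of radical `≤ R` is an envelope triple, `c ≤ e^{B'} R exp((log R)^θ)`, because
`A (log rad)^τ ≤ B' + (log rad)^θ` (threshold argument of `SubmultOfRST.exists_threshold` / `slack_le`) and the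
envelope is monotone in the scale. [folklore] -/
theorem ScaleSubmultiplicativity.envelopeWitnesses_of_subpowerSlack :
    (∃ τ : ℝ, τ < 1 ∧ ∃ A : ℝ, ∀ a b c : ℕ, IsABCTriple a b c →
      (c : ℝ) < ((rad a b c : ℕ) : ℝ) * Real.exp (A * Real.log ((rad a b c : ℕ) : ℝ) ^ τ)) →
    ∃ θ : ℝ, 0 ≤ θ ∧ θ < 1 ∧ ∃ K : ℝ, 0 < K ∧ ∃ B : ℝ, ∃ R₀ : ℕ, ∀ R₁ R₂ : ℕ, R₀ ≤ R₁ → R₀ ≤ R₂ →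
      ∀ a b c : ℕ, IsABCTriple a b c → rad a b c ≤ R₁ * R₂ →
      ∃ a₁ b₁ c₁ a₂ b₂ c₂ : ℕ, IsABCTriple a₁ b₁ c₁ ∧ rad a₁ b₁ c₁ ≤ R₁ ∧
        (c₁ : ℝ) ≤ Real.exp B * (R₁ : ℝ) * Real.exp (Real.log (R₁ : ℝ) ^ θ) ∧
        IsABCTriple a₂ b₂ c₂ ∧ rad a₂ b₂ c₂ ≤ R₂ ∧
        (c₂ : ℝ) ≤ Real.exp B * (R₂ : ℝ) * Real.exp (Real.log (R₂ : ℝ) ^ θ) ∧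
        (c : ℝ) ≤ K * Real.exp (Real.log ((R₁ : ℝ) * R₂) ^ θ) * c₁ * c₂ := by
  rintro ⟨τ, hτ1, A, hA⟩
  set t : ℝ := max τ 0 with ht_def
  have ht0 : 0 ≤ t := le_max_right _ _
  have ht1 : t < 1 := max_lt hτ1 one_pos
  have htθ : max τ 0 < (1 + t) / 2 := by rw [← ht_def]; linarith
  -- the shadows, at exponent `θ = (1+t)/2`
  obtain ⟨K, hK, R₀, hS⟩ := ScaleSubmultiplicativity.at_exponent_of_subpowerSlack τ A ((1 + t) / 2) htθ hA
  -- the pointwise envelope at the same exponent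
  set B : ℝ := |A| * max 1 (Real.log 2 ^ τ) with hB_def
  set s : ℝ := (1 - t) / 2 with hs_def
  have hs : 0 < s := by rw [hs_def]; linarith
  obtain ⟨N₀, hN₀⟩ := SubmultOfRST.exists_threshold B hs
  set B' : ℝ := max (B * Real.log (N₀ : ℝ) ^ t) 0 with hB'_def
  have hB'0 : 0 ≤ B' := le_max_right _ _
  have henv : ∀ a b c : ℕ, IsABCTriple a b c → ∀ R : ℕ, rad a b c ≤ R →
      (c : ℝ) ≤ Real.exp B' * (R : ℝ) * Real.exp (Real.log (R : ℝ) ^ ((1 + t) / 2)) := by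
    intro a b c habc R hR
    have hrad2 : (2 : ℝ) ≤ ((rad a b c : ℕ) : ℝ) := by exact_mod_cast SubmultOfRST.two_le_rad habc
    have hrad0 : (0 : ℝ) ≤ ((rad a b c : ℕ) : ℝ) := Nat.cast_nonneg _
    have hrad1 : (1 : ℝ) ≤ ((rad a b c : ℕ) : ℝ) := by linarith
    have hlog0 : 0 ≤ Real.log ((rad a b c : ℕ) : ℝ) := Real.log_nonneg hrad1
    have hθ0 : 0 ≤ Real.log ((rad a b c : ℕ) : ℝ) ^ ((1 + t) / 2) := Real.rpow_nonneg hlog0 _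
    have hradR : ((rad a b c : ℕ) : ℝ) ≤ (R : ℝ) := by exact_mod_cast hR
    -- `A (log rad)^τ ≤ B' + (log rad)^θ`
    have hexp : A * Real.log ((rad a b c : ℕ) : ℝ) ^ τ
        ≤ B' + Real.log ((rad a b c : ℕ) : ℝ) ^ ((1 + t) / 2) := by
      rcases le_or_gt N₀ (rad a b c) with hN | hN
      · calc A * Real.log ((rad a b c : ℕ) : ℝ) ^ τ ≤ B * Real.log ((rad a b c : ℕ) : ℝ) ^ t :=
              SubmultOfRST.slack_le habc le_rfl
          _ ≤ Real.log ((rad a b c : ℕ) : ℝ) ^ s * Real.log ((rad a b c : ℕ) : ℝ) ^ t :=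
              mul_le_mul_of_nonneg_right (hN₀ _ hN) (Real.rpow_nonneg hlog0 t)
          _ = Real.log ((rad a b c : ℕ) : ℝ) ^ (s + t) := (Real.rpow_add_of_nonneg hlog0 hs.le ht0).symm
          _ = Real.log ((rad a b c : ℕ) : ℝ) ^ ((1 + t) / 2) := by rw [hs_def]; ring_nf
          _ ≤ B' + Real.log ((rad a b c : ℕ) : ℝ) ^ ((1 + t) / 2) := le_add_of_nonneg_left hB'0
      · calc A * Real.log ((rad a b c : ℕ) : ℝ) ^ τ ≤ B * Real.log (N₀ : ℝ) ^ t :=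
              SubmultOfRST.slack_le habc hN.le
          _ ≤ B' := le_max_left _ _
          _ ≤ B' + Real.log ((rad a b c : ℕ) : ℝ) ^ ((1 + t) / 2) := le_add_of_nonneg_right hθ0
    calc (c : ℝ) ≤ ((rad a b c : ℕ) : ℝ) * Real.exp (A * Real.log ((rad a b c : ℕ) : ℝ) ^ τ) :=
          (hA a b c habc).le
      _ ≤ ((rad a b c : ℕ) : ℝ) * Real.exp (B' + Real.log ((rad a b c : ℕ) : ℝ) ^ ((1 + t) / 2)) :=
          mul_le_mul_of_nonneg_left (Real.exp_le_exp.mpr hexp) hrad0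
      _ = Real.exp B' * ((rad a b c : ℕ) : ℝ) * Real.exp (Real.log ((rad a b c : ℕ) : ℝ) ^ ((1 + t) / 2)) := by
          rw [Real.exp_add]; ring
      _ ≤ Real.exp B' * (R : ℝ) * Real.exp (Real.log (R : ℝ) ^ ((1 + t) / 2)) :=
          mul_le_mul (mul_le_mul_of_nonneg_left hradR (Real.exp_pos _).le)
            (exp_log_rpow_mono hrad1 hradR (by linarith)) (Real.exp_pos _).le (by positivity)
  refine ⟨(1 + t) / 2, by linarith, by linarith, K, hK, B', R₀, fun R₁ R₂ hR₁ hR₂ a b c habc hrad => ?_⟩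
  obtain ⟨a₁, b₁, c₁, a₂, b₂, c₂, h₁, hr₁, h₂, hr₂, hc⟩ := hS R₁ R₂ hR₁ hR₂ a b c habc hrad
  exact ⟨a₁, b₁, c₁, a₂, b₂, c₂, h₁, hr₁, henv a₁ b₁ c₁ h₁ R₁ hr₁, h₂, hr₂, henv a₂ b₂ c₂ h₂ R₂ hr₂, hc⟩

/-! ### The equivalence, and what an envelope-witness proof buys on top of the crux -/

/-- **Witness saturation, as an equivalence.**  The crux of stmt-ABC-2160 WITH ENVELOPE WITNESSES (some
`θ ∈ [0,1)`, `K > 0`, `B`, `R₀`; shadows of radical `≤ Rᵢ` and height `≤ e^B Rᵢ exp((log Rᵢ)^θ)`) is equivalent to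
the pointwise sub-power slack `∃ τ < 1, ∃ A, ∀ abc triples, c < rad · exp(A (log rad)^τ)` — the hypothesis of the
support item `SubmultOfRST` (stmt-ABC-10340), i.e. Robert–Stewart–Tenenbaum-upper-lite, which implies `ABC`
(`Target.abc_of_subPowerSlack`).  The plain crux is implied by either side (`submultOfRST_proof`); the converse
(crux ⟹ sub-power slack) is NOT claimed. [folklore] -/
theorem ScaleSubmultiplicativity.envelopeWitnesses_iff_subpowerSlack :
    (∃ θ : ℝ, 0 ≤ θ ∧ θ < 1 ∧ ∃ K : ℝ, 0 < K ∧ ∃ B : ℝ, ∃ R₀ : ℕ, ∀ R₁ R₂ : ℕ, R₀ ≤ R₁ → R₀ ≤ R₂ →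
      ∀ a b c : ℕ, IsABCTriple a b c → rad a b c ≤ R₁ * R₂ →
      ∃ a₁ b₁ c₁ a₂ b₂ c₂ : ℕ, IsABCTriple a₁ b₁ c₁ ∧ rad a₁ b₁ c₁ ≤ R₁ ∧
        (c₁ : ℝ) ≤ Real.exp B * (R₁ : ℝ) * Real.exp (Real.log (R₁ : ℝ) ^ θ) ∧
        IsABCTriple a₂ b₂ c₂ ∧ rad a₂ b₂ c₂ ≤ R₂ ∧
        (c₂ : ℝ) ≤ Real.exp B * (R₂ : ℝ) * Real.exp (Real.log (R₂ : ℝ) ^ θ) ∧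
        (c : ℝ) ≤ K * Real.exp (Real.log ((R₁ : ℝ) * R₂) ^ θ) * c₁ * c₂) ↔
    (∃ τ : ℝ, τ < 1 ∧ ∃ A : ℝ, ∀ a b c : ℕ, IsABCTriple a b c →
      (c : ℝ) < ((rad a b c : ℕ) : ℝ) * Real.exp (A * Real.log ((rad a b c : ℕ) : ℝ) ^ τ)) :=
  ⟨ScaleSubmultiplicativity.subpowerSlack_of_envelopeWitnesses,
    ScaleSubmultiplicativity.envelopeWitnesses_of_subpowerSlack⟩

/-- **What an envelope-witness proof of the crux proves on top of the crux: effective good scales.**  Through the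
landed calibration `calib_subPowerSlack_iff_scaleSubmultiplicativity_and_effectiveGoodScales` of the sibling crux
`Target` (stmt-ABC-2159), the envelope-witness form of stmt-ABC-2160 is equivalent to the conjunction of the crux
itself and EFFECTIVE GOOD SCALES: constants `B, C` such that every scale `R ≥ exp(C δ^{-B})` is `(1+δ)`-good
(`c ≤ R^{1+δ}` for every abc triple of radical `≤ R`, all `0 < δ ≤ 1`) — abc with a quasi-polynomial constant.
So the distance between "the crux" and "the crux by certified witnesses" is exactly an effective abc theorem.
[folklore] -/
theorem ScaleSubmultiplicativity.envelopeWitnesses_iff_scaleSubmultiplicativity_and_effectiveGoodScales :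
    (∃ θ : ℝ, 0 ≤ θ ∧ θ < 1 ∧ ∃ K : ℝ, 0 < K ∧ ∃ B : ℝ, ∃ R₀ : ℕ, ∀ R₁ R₂ : ℕ, R₀ ≤ R₁ → R₀ ≤ R₂ →
      ∀ a b c : ℕ, IsABCTriple a b c → rad a b c ≤ R₁ * R₂ →
      ∃ a₁ b₁ c₁ a₂ b₂ c₂ : ℕ, IsABCTriple a₁ b₁ c₁ ∧ rad a₁ b₁ c₁ ≤ R₁ ∧
        (c₁ : ℝ) ≤ Real.exp B * (R₁ : ℝ) * Real.exp (Real.log (R₁ : ℝ) ^ θ) ∧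
        IsABCTriple a₂ b₂ c₂ ∧ rad a₂ b₂ c₂ ≤ R₂ ∧
        (c₂ : ℝ) ≤ Real.exp B * (R₂ : ℝ) * Real.exp (Real.log (R₂ : ℝ) ^ θ) ∧
        (c : ℝ) ≤ K * Real.exp (Real.log ((R₁ : ℝ) * R₂) ^ θ) * c₁ * c₂) ↔
    (Summit.ABC.ABC.Theses.FeketeScales.ScaleSubmultiplicativity ∧
      ∃ B C : ℝ, ∀ δ : ℝ, 0 < δ → δ ≤ 1 → ∀ R : ℕ, Real.exp (C * δ ^ (-B)) ≤ (R : ℝ) →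
        ∀ a b c : ℕ, IsABCTriple a b c → rad a b c ≤ R → (c : ℝ) ≤ (R : ℝ) ^ (1 + δ)) :=
  ScaleSubmultiplicativity.envelopeWitnesses_iff_subpowerSlack.trans
    calib_subPowerSlack_iff_scaleSubmultiplicativity_and_effectiveGoodScales

end Summit.ABC.ABC.Theorems
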